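import Summits.AtomisticToContinuum.Crystallization.Theorems.FreeSplittingCertificatesRadiusLadderJointSiteNat

/-!
# Joint multi-shell certificates — general positive-definite kernel bases and Schur products (`FiniteRangeSplitting`, stmt-AtomisticToContinuum-12559)

Support theorem for crux r2 of route `FreeSplittingCertificates` (block-2b unit `b2b-freesplit-A`, gen 41).
VALUE = the site bound of `site_sum_le_of_jointCert_nat` (`…RadiusLadderJointSiteNat`) for an ARBITRARY family of univariate
angular kernels `κ k` that are `1` at `t = 1`, constant `1` for `k = 0`, and positive definite on unit vectors of `ℝ³` — and its
instance for the SCHUR-PRODUCT basis `κ k = P_{deg k} · P_{deg' k}` (products of two Legendre polynomials of degree `≤ 7`,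
positive definite by `schur_product_pd` and the tree's closed-form addition theorems `legPℓ_inner_eq`).  This lets a numerical
certificate use angular information of degree up to `14` without new addition theorems — NOT summit progress; the cell's
`R = 2` verdict is unchanged.

Contents: `gram_of_addition` / `legPn_gram` (unweighted Gram factorisations of `P_d` on `S²`, absorbing `√λ_m`),
`legPn_mul_pd` (PD of `P_a · P_b`), `site_sum_le_of_jointCertK_nat` (general kernel family, integer capacities),
`site_sum_le_of_jointCertP_nat` (the product basis).
-/

noncomputable section

namespace Summit.AtomisticToContinuum.Crystallization.Theorems.StrictSplittingRuleBirth

open scoped BigOperators Classical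
open Literature.MathematicalPhysics.StatisticalMechanics

/-! ## Gram factorisations of `P_d` on unit vectors and positive definiteness of products -/

/-- From a weighted addition formula `P(⟪x,y⟫) = ∑ λ_m h_m(x) h_m(y)` with `λ ≥ 0` to an unweighted Gram factorisation
(absorb `√λ_m` into both factors). -/
theorem gram_of_addition {M : ℕ} (P : ℝ → ℝ) (lam : Fin M → ℝ) (h : Fin M → EuclideanSpace ℝ (Fin 3) → ℝ)
    (hlam : ∀ m, 0 ≤ lam m)
    (hP : ∀ x y : EuclideanSpace ℝ (Fin 3), ‖x‖ = 1 → ‖y‖ = 1 → P (inner ℝ x y) = ∑ m, lam m * h m x * h m y) :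
    ∃ (M' : ℕ) (g : Fin M' → EuclideanSpace ℝ (Fin 3) → ℝ),
      ∀ x y : EuclideanSpace ℝ (Fin 3), ‖x‖ = 1 → ‖y‖ = 1 → P (inner ℝ x y) = ∑ m, g m x * g m y := by
  refine ⟨M, fun m x => Real.sqrt (lam m) * h m x, fun x y hx hy => ?_⟩
  rw [hP x y hx hy]
  refine Finset.sum_congr rfl fun m _ => ?_
  have hs : Real.sqrt (lam m) * Real.sqrt (lam m) = lam m := Real.mul_self_sqrt (hlam m)
  calc lam m * h m x * h m y = Real.sqrt (lam m) * Real.sqrt (lam m) * h m x * h m y := by rw [hs]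
    _ = Real.sqrt (lam m) * h m x * (Real.sqrt (lam m) * h m y) := by ring

/-- **Every `legPn d` is a finite Gram kernel on unit vectors of `ℝ³`** (closed forms for `d ≤ 7`, the constant kernel otherwise). -/
theorem legPn_gram (d : ℕ) : ∃ (M : ℕ) (g : Fin M → EuclideanSpace ℝ (Fin 3) → ℝ),
    ∀ x y : EuclideanSpace ℝ (Fin 3), ‖x‖ = 1 → ‖y‖ = 1 → legPn d (inner ℝ x y) = ∑ m, g m x * g m y := by
  have hconst : ∃ (M : ℕ) (g : Fin M → EuclideanSpace ℝ (Fin 3) → ℝ),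
      ∀ x y : EuclideanSpace ℝ (Fin 3), ‖x‖ = 1 → ‖y‖ = 1 → (1 : ℝ) = ∑ m, g m x * g m y :=
    ⟨1, fun _ _ => 1, fun x y _ _ => by simp⟩
  rcases d with _ | _ | _ | _ | _ | _ | _ | _ | d
  · exact hconst
  · exact gram_of_addition legP1 lam1 harm1 (fun m => by fin_cases m <;> norm_num [lam1]) legP1_inner_eq
  · exact gram_of_addition legP2 lam2 harm2 (fun m => by fin_cases m <;> norm_num [lam2]) legP2_inner_eq
  · exact gram_of_addition legP3 lam3 harm3 (fun m => by fin_cases m <;> norm_num [lam3]) legP3_inner_eq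
  · exact gram_of_addition legP4 lam4 harm4 (fun m => by fin_cases m <;> norm_num [lam4]) legP4_inner_eq
  · exact gram_of_addition legP5 lam5 harm5 (fun m => by fin_cases m <;> norm_num [lam5]) legP5_inner_eq
  · exact gram_of_addition legP6 lam6 harm6 (fun m => by fin_cases m <;> norm_num [lam6]) legP6_inner_eq
  · exact gram_of_addition legP7 lam7 harm7 (fun m => by fin_cases m <;> norm_num [lam7]) legP7_inner_eq
  · exact hconst

/-- **Weighted positive definiteness of the Schur product `P_a · P_b` on unit vectors** (`a`, `b` arbitrary). -/
theorem legPn_mul_pd (a b : ℕ) {ι : Type*} [Fintype ι] (u : ι → EuclideanSpace ℝ (Fin 3)) (hu : ∀ j, ‖u j‖ = 1)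
    (w : ι → ℝ) :
    0 ≤ ∑ j, ∑ j', w j * w j' * (legPn a (inner ℝ (u j) (u j')) * legPn b (inner ℝ (u j) (u j'))) := by
  obtain ⟨M, g, hg⟩ := legPn_gram a
  obtain ⟨M', g', hg'⟩ := legPn_gram b
  exact schur_product_pd (fun m j => g m (u j)) (fun m j => g' m (u j))
    (fun j j' => legPn a (inner ℝ (u j) (u j'))) (fun j j' => legPn b (inner ℝ (u j) (u j')))
    (fun j j' => hg _ _ (hu j) (hu j')) (fun j j' => hg' _ _ (hu j) (hu j')) w

/-! ## The site bound for a general positive-definite kernel family -/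

/-- **From a joint multi-shell certificate table over a general kernel family to a site bound** (integer capacities).
As `site_sum_le_of_jointCert_nat`, with the Legendre family `P_{deg k}` replaced by any univariate family `κ k` with
`κ 0 ≡ 1`, `κ k 1 = 1`, and `(j, j') ↦ κ k ⟪u_j, u_j'⟫` positive definite (as a weighted quadratic form) for unit vectors. -/
theorem site_sum_le_of_jointCertK_nat {n L Q : ℕ} {μ : Type*} [Fintype μ] {δ : ℝ} (hδ : 0 < δ) (e : ℕ → ℝ)
    (he0 : e 0 = δ) (hmono : ∀ k, k < n → e k < e (k + 1)) (hn : 0 < n)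
    (κ : Fin (L + 1) → ℝ → ℝ) (hκ0 : ∀ t, κ 0 t = 1) (hκ1 : ∀ k, κ k 1 = 1)
    (hκpd : ∀ k, ∀ {ι : Type} [Fintype ι] (u : ι → EuclideanSpace ℝ (Fin 3)), (∀ j, ‖u j‖ = 1) →
      ∀ a : ι → ℝ, 0 ≤ ∑ j, ∑ j', a j * a j' * κ k (inner ℝ (u j) (u j')))
    (β₀ : ℝ) (b w : Fin n → ℝ) (G : Fin (L + 1) → Fin n → Fin n → ℝ) (R : Fin (L + 1) → μ → Fin n → ℝ)
    (hZ : ∀ v : Fin n → ℝ, 0 ≤ β₀ + 2 * ∑ i, b i * v i + ∑ i, ∑ i', v i * v i' * G 0 i i')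
    (hG : ∀ k, k ≠ 0 → ∀ i i', G k i i' = ∑ m, R k m i * R k m i')
    (hOFF : ∀ i i' : Fin n, ∀ t : ℝ, -1 ≤ t → t ≤ 1 → t ≤ cbar4 δ (e i) (e (i + 1)) (e i') (e (i' + 1)) →
      ∑ k, G k i i' * κ k t ≤ 0)
    (S : Fin Q → Finset (Fin n)) (lam : Fin Q → ℝ) (m : Fin Q → ℕ) (hlam : ∀ q, 0 ≤ lam q)
    (top : Fin Q → ℕ) (htop : ∀ q, top q ≤ n) (hS : ∀ q i, i ∈ S q → (i : ℕ) < top q)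
    (hm : ∀ q, (2 * e (top q) / δ + 1) ^ 3 - 1 < (m q : ℝ) + 1)
    (hDIAG : ∀ i, 2 * b i + ∑ k, G k i i + w i ≤ ∑ q, if i ∈ S q then lam q else 0)
    (φ : ℝ → ℝ) (hw : ∀ i : Fin n, ∀ r, e i ≤ r → r < e (i + 1) → φ r ≤ w i)
    {N : ℕ} {x : Fin N → EuclideanSpace ℝ (Fin 3)} (hx : Sep δ x) (i : Fin N) :
    ∑ j ∈ (Finset.univ.erase i).filter (fun j => dist (x i) (x j) < e n), φ (dist (x i) (x j)) ≤
      β₀ + ∑ q, lam q * (m q : ℝ) := by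
  classical
  set F := (Finset.univ.erase i).filter (fun j => dist (x i) (x j) < e n) with hF
  have hmono' := edges_mono hmono
  have hFd : ∀ j ∈ F, δ ≤ dist (x i) (x j) ∧ dist (x i) (x j) < e n := fun j hj => by
    obtain ⟨hji, hjn⟩ := Finset.mem_filter.1 hj
    exact ⟨hx i j (Finset.ne_of_mem_erase hji).symm, hjn⟩
  let c : F → Fin n := fun j => ⟨cellOf e n (dist (x i) (x j)), lt_of_le_of_lt (cellOf_le e n _) (Nat.sub_lt hn one_pos)⟩
  have hc1 : ∀ j : F, e (c j) ≤ dist (x i) (x j) := fun j =>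
    edge_cellOf_le (he0 ▸ (hFd j j.2).1)
  have hc2 : ∀ j : F, dist (x i) (x j) < e ((c j : ℕ) + 1) := fun j =>
    lt_edge_cellOf_succ hn (hFd j j.2).2
  let y : F → EuclideanSpace ℝ (Fin 3) := fun j => x j - x i
  have hy : ∀ j : F, ‖y j‖ = dist (x i) (x j) := fun j => by
    simp only [y]; rw [← dist_eq_norm, dist_comm]
  have hy0 : ∀ j : F, y j ≠ 0 := fun j => by
    rw [← norm_ne_zero_iff, hy]; exact (lt_of_lt_of_le hδ (hFd j j.2).1).ne'
  let u : F → EuclideanSpace ℝ (Fin 3) := fun j => (‖y j‖⁻¹) • y j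
  have hu : ∀ j : F, ‖u j‖ = 1 := fun j => norm_unitDir (hy0 j)
  let K : Fin (L + 1) → F → F → ℝ := fun k j j' => κ k (inner ℝ (u j) (u j'))
  have hK0 : ∀ j j', K 0 j j' = 1 := fun j j' => by simp only [K, hκ0]
  have hKdiag : ∀ k j, K k j j = 1 := fun k j => by
    simp only [K]
    rw [inner_self_eq_one_of_norm (hu j), hκ1]
  have hKpd : ∀ k (a : F → ℝ), 0 ≤ ∑ j, ∑ j', a j * a j' * K k j j' := fun k a => hκpd k u hu a
  have hOFF' : ∀ j j' : F, j ≠ j' → ∑ k, G k (c j) (c j') * K k j j' ≤ 0 := by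
    intro j j' hjj'
    have hne : (j : Fin N) ≠ j' := fun h => hjj' (Subtype.ext h)
    have hsep : δ ≤ ‖y j - y j'‖ := by
      have : y j - y j' = x j - x j' := by simp only [y]; abel
      rw [this, ← dist_eq_norm]; exact hx j j' hne
    have ht1 : -1 ≤ inner ℝ (u j) (u j') := neg_one_le_inner_unitDir (hy0 j) (hy0 j')
    have ht1' : inner ℝ (u j) (u j') ≤ 1 := by
      have := real_inner_le_norm (u j) (u j'); rw [hu j, hu j', mul_one] at this; exact this
    have ht2 : inner ℝ (u j) (u j') ≤ cbar4 δ (e (c j)) (e ((c j : ℕ) + 1)) (e (c j')) (e ((c j' : ℕ) + 1)) := by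
      refine inner_unitDir_le_cbar4 hδ ?_ ?_ ?_ ?_ ?_ ?_ hsep
      · rw [← he0]; exact hmono' 0 _ (Nat.zero_le _) ((cellOf_le e n _).trans (Nat.sub_le n 1))
      · rw [← he0]; exact hmono' 0 _ (Nat.zero_le _) ((cellOf_le e n _).trans (Nat.sub_le n 1))
      · rw [hy]; exact hc1 j
      · rw [hy]; exact (hc2 j).le
      · rw [hy]; exact hc1 j'
      · rw [hy]; exact (hc2 j').le
    exact hOFF (c j) (c j') _ ht1 ht1' ht2
  -- counts (ball packing + integrality)
  have hcount : ∀ q, (∑ j : F, (if c j ∈ S q then (1 : ℝ) else 0)) ≤ (m q : ℝ) := by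
    intro q
    have hsub : ∀ j : F, c j ∈ S q → dist (x i) (x j) < e (top q) := fun j hj =>
      lt_of_lt_of_le (hc2 j) (hmono' _ _ (Nat.succ_le_of_lt (hS q (c j) hj)) (htop q))
    have h1 : (∑ j : F, (if c j ∈ S q then (1 : ℝ) else 0)) ≤
        ∑ j : F, (if dist (x i) (x j) < e (top q) then (1 : ℝ) else 0) :=
      Finset.sum_le_sum fun j _ => by
        by_cases h : c j ∈ S q
        · rw [if_pos h, if_pos (hsub j h)]
        · rw [if_neg h]; split_ifs <;> norm_num
    have h2 : (∑ j : F, (if dist (x i) (x j) < e (top q) then (1 : ℝ) else 0)) =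
        (((F.filter fun j => dist (x i) (x j) < e (top q)).card : ℕ) : ℝ) := by
      rw [Finset.card_filter, Nat.cast_sum]
      rw [← Finset.sum_coe_sort F]
      simp
    have h3 : (F.filter fun j => dist (x i) (x j) < e (top q)).card ≤
        ((Finset.univ.erase i).filter fun j => dist (x i) (x j) < e (top q)).card :=
      Finset.card_le_card (fun j hj => by
        obtain ⟨hjF, hjt⟩ := Finset.mem_filter.1 hj
        exact Finset.mem_filter.2 ⟨(Finset.mem_filter.1 hjF).1, hjt⟩)
    have h4 := card_near_le hδ hx i (le_of_lt (lt_of_lt_of_le hδ (he0 ▸ hmono' 0 _ (Nat.zero_le _) (htop q))))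
      (t := e (top q))
    have h5 : ((Finset.univ.erase i).filter fun j => dist (x i) (x j) < e (top q)).card ≤ m q :=
      nat_le_of_le_of_lt_succ h4 (hm q)
    have h6 : (((F.filter fun j => dist (x i) (x j) < e (top q)).card : ℕ) : ℝ) ≤ (m q : ℝ) := by
      exact_mod_cast h3.trans h5
    rw [h2] at h1
    exact h1.trans h6
  have main := jointCert_sound c K hK0 hKdiag hKpd β₀ b G R hZ hG hOFF' S lam (fun q => (m q : ℝ)) hlam hcount w hDIAG
  calc ∑ j ∈ F, φ (dist (x i) (x j)) = ∑ j : F, φ (dist (x i) (x j)) := (Finset.sum_coe_sort F _).symm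
    _ ≤ ∑ j : F, w (c j) := Finset.sum_le_sum fun j _ => hw (c j) _ (hc1 j) (hc2 j)
    _ ≤ β₀ + ∑ q, lam q * (m q : ℝ) := main

/-! ## The Schur-product basis `P_{deg k} · P_{deg' k}` -/

/-- **From a joint multi-shell certificate table over the product basis `P_{deg k} · P_{deg' k}` to a site bound**
(integer capacities; `deg 0 = deg' 0 = 0` makes `k = 0` the constant kernel; `deg' k = 0` recovers plain `P_{deg k}`). -/
theorem site_sum_le_of_jointCertP_nat {n L Q : ℕ} {μ : Type*} [Fintype μ] {δ : ℝ} (hδ : 0 < δ) (e : ℕ → ℝ)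
    (he0 : e 0 = δ) (hmono : ∀ k, k < n → e k < e (k + 1)) (hn : 0 < n)
    (deg deg' : Fin (L + 1) → ℕ) (hdeg0 : deg 0 = 0) (hdeg0' : deg' 0 = 0)
    (β₀ : ℝ) (b w : Fin n → ℝ) (G : Fin (L + 1) → Fin n → Fin n → ℝ) (R : Fin (L + 1) → μ → Fin n → ℝ)
    (hZ : ∀ v : Fin n → ℝ, 0 ≤ β₀ + 2 * ∑ i, b i * v i + ∑ i, ∑ i', v i * v i' * G 0 i i')
    (hG : ∀ k, k ≠ 0 → ∀ i i', G k i i' = ∑ m, R k m i * R k m i')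
    (hOFF : ∀ i i' : Fin n, ∀ t : ℝ, -1 ≤ t → t ≤ 1 → t ≤ cbar4 δ (e i) (e (i + 1)) (e i') (e (i' + 1)) →
      ∑ k, G k i i' * (legPn (deg k) t * legPn (deg' k) t) ≤ 0)
    (S : Fin Q → Finset (Fin n)) (lam : Fin Q → ℝ) (m : Fin Q → ℕ) (hlam : ∀ q, 0 ≤ lam q)
    (top : Fin Q → ℕ) (htop : ∀ q, top q ≤ n) (hS : ∀ q i, i ∈ S q → (i : ℕ) < top q)
    (hm : ∀ q, (2 * e (top q) / δ + 1) ^ 3 - 1 < (m q : ℝ) + 1)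
    (hDIAG : ∀ i, 2 * b i + ∑ k, G k i i + w i ≤ ∑ q, if i ∈ S q then lam q else 0)
    (φ : ℝ → ℝ) (hw : ∀ i : Fin n, ∀ r, e i ≤ r → r < e (i + 1) → φ r ≤ w i)
    {N : ℕ} {x : Fin N → EuclideanSpace ℝ (Fin 3)} (hx : Sep δ x) (i : Fin N) :
    ∑ j ∈ (Finset.univ.erase i).filter (fun j => dist (x i) (x j) < e n), φ (dist (x i) (x j)) ≤
      β₀ + ∑ q, lam q * (m q : ℝ) :=
  site_sum_le_of_jointCertK_nat hδ e he0 hmono hn (fun k t => legPn (deg k) t * legPn (deg' k) t)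
    (fun t => by simp only [hdeg0, hdeg0', legPn_zero, mul_one])
    (fun k => by simp only [legPn_one, mul_one])
    (fun k _ _ u hu a => legPn_mul_pd (deg k) (deg' k) u hu a)
    β₀ b w G R hZ hG hOFF S lam m hlam top htop hS hm hDIAG φ hw hx i

end Summit.AtomisticToContinuum.Crystallization.Theorems.StrictSplittingRuleBirth

end
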